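import Summits.AnomalousDissipation.AnomalousDissipation.Theses.TwoAndHalfD
import Literature.Analysis.FluidPDE.TorusClassicalLerayHopfProofs
import Literature.Analysis.FluidPDE.PassiveScalarWellPosedness
import Literature.Analysis.FluidPDE.PassiveScalarClassicalEnergy
import Literature.Barriers.AnomalousDissipation.GravestModeLaminarAttractorSwept
import Summits.AnomalousDissipation.AnomalousDissipation.Theorems.ScalarAnomalySteadySourceFormal.Negative.ForcedClassicalWeak
import Summits.AnomalousDissipation.AnomalousDissipation.Theorems.ScalarAnomalySteadySourceFormal.Negative.LoadBearing

/-!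
# Line `budgeted-mixer-template` for crux `TwoAndHalfD.ScalarAnomalySteadySourceFormal`
# (stmt-AnomalousDissipation-0448) — checked skeleton (crux-plan, round 1, 2026-08-16)

Idea card: `Cruxes/ScalarAnomalySteadySourceFormal/Ideas/budgeted-mixer-template.md` (crux-ideate r1,
ideator 1; triage r1-1/2/3: pass, with the sharpening "the decay spec must be SECTOR-restricted —
the data-universal `UniformPropagatorDecay` is false for every bounded-energy 2-D NS family at
`Pr = 1` (finding ★, vorticity twin)", merge of the transfer half with `lp-flux-locality-threshold`
3b). Line card: `Lines/budgeted-mixer-template.md`.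

THE LINE (transfer). The crux's two scalar clauses — `ν`-uniformly bounded limsup-mean VARIANCE of
the steadily sourced scalar and a dissipation FLOOR — are transferred to ONE scalar-source-free,
finite-window, junk-free specification on the planar Navier–Stokes family alone (S1, the residual
crux `C⁺`): along `ν_j → 0`, classical solutions `v_j` of NS forced by one steady `g`, with pointwise
bounded energy, whose scalar propagator (diffusivity `ν_j`, Prandtl one)
 (a) HALVES, within one fixed time `τ`, every released blob whose datum lies in a propagator-invariant
     class `S` of profiles (the "sector": in the intended instance the odd isotypic sector of a point
     symmetry of `(g, data)`, which never contains the vorticity — finding ★ of the triage), and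
 (b) feeds a COLD START (zero datum, source `h`) an input power `∫ h·ρ ≥ c₀ > 0` at the fixed lag `nτ`,
uniformly in `j` and in the release / start time. The transfer is three honest linear-PDE lemmas over a
smooth divergence-free drift: S2 (restart ⇒ the cold-start solution exists globally and has
`sup_t ‖θ_j(t)‖² ≤ 4τ²‖h‖²` — the HARD clause (v) of the crux, cf. `Negative.cruxWithoutVarianceBound_holds`),
S3 (iterated halving kills the memory of `θ_j(t-nτ)`, so the input power `∫ h θ_j(t) ≥ c₀/2` for
`t ≥ nτ`), S4 (energy identity of the sourced equation in limsup form: mean dissipation = mean input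
power ≥ eventual pointwise floor). The a-priori NS budgets (energy, `ν⟨‖∇v‖²⟩ ≤ ‖g‖U`,
`ν⟨‖Δv‖²⟩ ≤ ‖Δg‖_∞U`) do not obstruct S1: the card's log log-deep ELM-tile template meets (a)(b) with
all three injections VANISHING (kinematic certificate `BudgetedMixerExists`, unregistered support, see
the line card) — so S1 is a statement about 2-D DYNAMICS only ("self-refining mixer on some invariant
set"), and `¬S1` is the uniform mixing-rate ceiling that would feed `TwohalfdNeg`.

STUBS (tree vocabulary only — no local `def`, no notation — so each lands verbatim as
`Theorems/ScalarAnomalySteadySourceFormal/<Stub>.lean --supports stmt-AnomalousDissipation-0448`):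
* S1 `stub_sectorMixerRealizable` — TRANSFER TARGET `C⁺` (K1 ∧ K3 of the card, sector form): NS
                                    realisability of the sector-halving + cold-start-floor spec. [XL, open]
* S2 `stub_coldStartVariance`     — global cold-start sourced solution + restart variance bound
                                    `‖θ(t)‖² ≤ 4τ²‖h‖²` from sector halving (card P1 / lp-flux 3b).   [M]
* S3 `stub_inputPowerFloor`       — cold-start floor at lag `nτ` + iterated sector halving ⇒
                                    `∫ h θ(t) ≥ c₀/2` for all `t ≥ nτ`.                             [M]
* S4 `stub_dissipationFromPower`  — sourced `L²` balance in limsup form: eventual input-power floor +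
                                    bounded variance ⇒ `e ≤ ⟨κ‖∇θ‖²⟩` (spectral, `toReal`).          [M−]
Composition `ScalarAnomalySteadySourceFormal_of` (kernel-checked, no sorry of its own): S1 gives the
data, the NS family and the spec; S2 gives `θ_j` (per `j`, `choose`) with the variance bound; S3 then S4
give the floor `c₀/2`; classical NS ⇒ global Leray–Hopf (`IsClassicalNSSolutionOn.isLerayHopfOn_of_convex`),
classical sourced ⇒ weak sourced (`Negative.isWeakScalarTransportForcedOn_of_classical`, landed),
pointwise ⇒ limsup-mean bounds (`meanEnergy_le_of_forall_le`, `longTimeAvgSup_le_of_forall_le`).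

DISPROOF USED (`Cruxes/ScalarAnomalySteadySourceFormal/Disproof.lean` @ 2026-08-16T01:55Z, gen 1
cycles 1–2b; no `_false_without_` theorem exists yet): §4 `cruxWithoutVarianceBound_holds` /
`varianceUnbounded_heatFamily` (clause (v) is THE load-bearing clause) — (v) is exactly what S2 earns
from halving, and S1 asks halving UNIFORMLY in `j` (at fixed `ν_j` Poincaré gives `τ_j ~ 1/ν_j`, no
content); §4 `cruxIndexedSource_holds` (any kill must use that `h` is ONE function) — S1 carries one
fixed `h` (and one `τ`, `c₀`, `n`) through the floor clause, uniformly in `j` (only the classes `S_j`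
may vary with `j`); §6 `not_cruxRestFlow` (flow at rest dead) — at
rest no `j`-uniform halving class containing a nonzero smooth mean-zero profile exists (heat:
`τ_j ≥ ln 2/(4π²ν_j)`) and `S_j = {0}` forces `h = 0` through the invariance clause, killing the
floor: consistent; §2 junk calculus — S1 contains NO `longTimeAvgSup`
(all clauses finite-window / pointwise), the two `≤` clauses of the crux are produced from POINTWISE
bounds (honest by `longTimeAvgSup_le_of_forall_le`), the floor is junk-proof anyway; §5(e) / triage
(β) Batchelor log: S1-witnesses need `‖∇v_j‖_∞ ≳ log(1/ν_j)` — allowed by the budgets, recorded in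
the line card as the design target `Lip ≈ log²`. Triage ★ (`HasUniformScalarDissipationTime` over ALL
data is false for NS families): honoured — halving is asked only on `S_j`, and the line card names the
instance `S_j = P-odd sector ∌ ω_j(t)`. No stub is an instance of a landed Negative lemma
(`Negative/{KillShape,LoadBearing,HeatProfile,RestFlowSteady,Forced*}`): S2–S4 are linear lemmas with
the drift universally quantified; S1 keeps `ν_j → 0`, one fixed `(g,h)`, and excludes rest/heat by the
floor. `ledger negatives --problem AnomalousDissipation` (13037/2984/2859/2979: 3-D ∀-data ceilings): none related.
-/

namespace Summit.AnomalousDissipation.AnomalousDissipation.Cruxes.ScalarAnomalySteadySourceFormal.BudgetedMixerTemplate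

open MeasureTheory Filter Topology
open scoped ENNReal NNReal
open Literature.Analysis.FunctionSpaces Literature.Analysis.FluidPDE

set_option linter.dupNamespace false

/-! ## S1 — the transfer target `C⁺`: NS-realisability of the sector mixing spec (K1 ∧ K3) -/

/-- **S1 `stub_sectorMixerRealizable` — TRANSFER TARGET `C⁺` (the residual crux; XL, OPEN).**
There are: a smooth divergence-free mean-zero steady planar force `g`, a smooth mean-zero source
profile `h`, viscosities `ν_j → 0`, CLASSICAL solutions `(v_j, p_j)` of the Navier–Stokes system
forced by `g` on `T² × [0, ∞)` (one per `j`; e.g. the solutions on an unstable periodic orbit or any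
invariant set), classes `S_j` of scalar profiles (one per `j`; a `j`-independent symmetry sector in the
intended instance), a halving time `τ > 0`, a floor `c₀ > 0`, a lag count
`n ≥ 1` and an energy level `E`, such that, for every `j`:
* (energy)   `∫ ‖v_j(t)‖² ≤ E` for all `t ≥ 0` (pointwise, hence honest);
* (Inv-0)    `S_j` is invariant under RELEASES: a classical solution of `∂ₜφ + v_j·∇φ = ν_jΔφ` on a
             window `[s, T']`, `s ≥ 0`, with `φ(s) ∈ S_j` stays in `S_j`;
* (Inv-h)    COLD STARTS stay in `S_j`: a classical solution of `∂ₜθ + v_j·∇θ = ν_jΔθ + h` on `[0, ∞)`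
             with `θ(0) = 0` has `θ(t) ∈ S_j` for all `t ≥ 0`;
* (Half)     SECTOR HALVING within `τ`, uniformly in `j` and the release time: every release with datum in `S_j`
             at time `s ≥ 0` has `‖φ(s+τ)‖² ≤ ¼‖φ(s)‖²`;
* (Floor)    COLD-START INPUT POWER at lag `nτ`, uniformly in the start time: every classical solution
             of the `h`-sourced equation on `[s, s+nτ]` from the zero datum has `∫ h·ρ(s+nτ) ≥ c₀`;
* (small)    `4τ‖h‖² ≤ 2ⁿ c₀` (after `n` halvings the memory of any state of size `2τ‖h‖` is below
             half the floor — a coupling the designer meets by taking `n` large, since for a mixing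
             family the cold-start power at lag `L` tends to the flux as `L → ∞`).
Intended instance (line card): `g` a `C₄`-equivariant two-shell force, `Fix(C₄)` data, `S` = the
`P`-odd (`x ↦ -x`) smooth profiles (propagator-invariant by equivariance + uniqueness
`Torus.IsClassicalScalarTransportForcedOn.eq_on_Icc`; never contains the vorticity, so triage ★ is
inert), `h = sin 2πx₁`-type; the NS family a self-refining mixer with `O(1)` velocity down to scale
`1/log²(1/ν_j)` (enstrophy `≈ log⁴`, palinstrophy `≈ log⁸`, all injections `→ 0`: budget-admissible
by the card's template). Why it might fail: 2-D dynamics may not sustain coherent fast eddies below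
the forcing scale on any invariant set (forward enstrophy-flux starvation; condensation to a
near-autonomous state: `τ_j ≳ ν_j^{-1/3}`); in the sector, persistent `O(1)` stagnation curves give
`κ^{-1/3}` critical-layer traps (triage r1-3 A4) — halving then fails even though the `m = 0` trap is
removed. `¬S1` for all `(g, S)` = a uniform mixing-rate ceiling for bounded-energy steadily forced
2-D NS, the negative side of the card's dichotomy. Sources: arXiv:2304.05374 Thm 1 (ELM: optimal
`|log ν|` for Lipschitz mixers ⇒ the active scale must refine like `1/log²`), arXiv:1310.2986 Thm 1.1,
arXiv:1911.11014 Rem 1.6–1.7 (fixed-`ν` analogue false), AlexakisDoering2006PLA §4, triage r1-1 ★. -/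
theorem stub_sectorMixerRealizable :
    ∃ (g : UnitAddTorus (Fin 2) → EuclideanSpace ℝ (Fin 2)) (h : UnitAddTorus (Fin 2) → ℝ),
      Torus.IsSmooth g ∧ Torus.IsDivFree g ∧ Torus.HasZeroMean g ∧
      Torus.IsSmooth h ∧ Torus.HasZeroMean h ∧
      ∃ (ν : ℕ → ℝ) (v : ℕ → ℝ → UnitAddTorus (Fin 2) → EuclideanSpace ℝ (Fin 2))
        (p : ℕ → ℝ → UnitAddTorus (Fin 2) → ℝ) (S : ℕ → Set (UnitAddTorus (Fin 2) → ℝ))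
        (τ E c₀ : ℝ) (n : ℕ),
        (∀ j, 0 < ν j) ∧ Tendsto ν atTop (𝓝 0) ∧ 0 < τ ∧ 0 < c₀ ∧ 1 ≤ n ∧
        4 * τ * Torus.scalarL2Sq h ≤ 2 ^ n * c₀ ∧
        (∀ j, Torus.IsClassicalNSSolutionOn (Set.Ici 0) (ν j) (fun _ => g) (v j) (p j)) ∧
        (∀ j t, 0 ≤ t → ∫ x, ‖v j t x‖ ^ 2 ≤ E) ∧
        -- (Inv-0) the class `S` is invariant under releases (unforced classical solutions)
        (∀ j (s T' : ℝ), 0 ≤ s → ∀ φ : ℝ → UnitAddTorus (Fin 2) → ℝ,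
            Torus.IsClassicalScalarTransportOn (Set.Icc s T') (ν j) (v j) φ → φ s ∈ S j →
            ∀ t ∈ Set.Icc s T', φ t ∈ S j) ∧
        -- (Inv-h) cold starts of the `h`-sourced problem stay in `S`
        (∀ j (θ : ℝ → UnitAddTorus (Fin 2) → ℝ),
            Torus.IsClassicalScalarTransportForcedOn (Set.Ici 0) (ν j) (v j) (fun _ => h) θ →
            θ 0 = (fun _ => (0 : ℝ)) → ∀ t, 0 ≤ t → θ t ∈ S j) ∧
        -- (Half) sector halving within `τ`, any release time
        (∀ j (s : ℝ), 0 ≤ s → ∀ φ : ℝ → UnitAddTorus (Fin 2) → ℝ,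
            Torus.IsClassicalScalarTransportOn (Set.Icc s (s + τ)) (ν j) (v j) φ → φ s ∈ S j →
            Torus.scalarL2Sq (φ (s + τ)) ≤ 4⁻¹ * Torus.scalarL2Sq (φ s)) ∧
        -- (Floor) cold-start input power at lag `n τ`, any start time
        (∀ j (s : ℝ), 0 ≤ s → ∀ ρ : ℝ → UnitAddTorus (Fin 2) → ℝ,
            Torus.IsClassicalScalarTransportForcedOn (Set.Icc s (s + n * τ)) (ν j) (v j) (fun _ => h) ρ →
            ρ s = (fun _ => (0 : ℝ)) → c₀ ≤ ∫ x, h x * ρ (s + n * τ) x) := by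
  sorry

/-! ## S2 — cold-start variance bound by restart (card P1 `DecayGivesBoundedVariance`, sector form) -/

/-- **S2 `stub_coldStartVariance` — the variance clause from sector halving (M).** Let `κ > 0`,
`τ > 0`, `u` a jointly smooth divergence-free drift on `T² × [0, ∞)`, `h` a smooth profile and `S`
a class of profiles such that (Half) every classical release `∂ₜφ + u·∇φ = κΔφ` on `[s, s+τ]`,
`s ≥ 0`, with `φ(s) ∈ S` has `‖φ(s+τ)‖² ≤ ¼‖φ(s)‖²`, and (Inv-h) every global classical cold start
of the `h`-sourced problem stays in `S`. THEN the cold start exists globally — a classical solution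
`θ` of `∂ₜθ + u·∇θ = κΔθ + h` on `[0, ∞)` with `θ(0) = 0` — and `‖θ(t)‖²_{L²} ≤ 4τ²‖h‖²_{L²}` for
all `t ≥ 0`. Proof route (restart; no Duhamel integral, no exponential rate needed): EXISTENCE by
gluing the tree's unique classical solutions on `[0, T]`
(`Torus.exists_unique_isClassicalScalarTransportForcedOn_holds`, PROVED; uniqueness `eq_on_Icc`
makes the `[0,T]`-solutions compatible, `ContDiffOn` is local, `derivWithin` within `Ici 0` and
within `Icc 0 T` agree below `T`); BOUND: on `[0, τ]` the sourced `L²` balance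
`d/dt ½‖θ‖² = -κ‖∇θ‖² + (h, θ) ≤ ‖h‖‖θ‖` gives `‖θ(r)‖ ≤ r‖h‖ ≤ τ‖h‖`; at any `t ≥ 0` split on
`[t, t+τ]`: `θ = φ + ρ`, `φ` the classical release from `θ(t) ∈ S` (exists: tree theorem after the
time shift `u(t+·)`; unique), `ρ = θ - φ` the cold start at `t` (linearity, cf.
`IsClassicalScalarTransportForcedOn.sub`), so `‖θ(t+τ)‖ ≤ ½‖θ(t)‖ + τ‖h‖` (Half + balance +
Minkowski); induction on `⌊t/τ⌋`: `sup ‖θ‖ ≤ 2τ‖h‖`. Uses (v)-side hypotheses only; honest at every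
fixed `κ` (no limsup). Leans on: `PassiveScalarWellPosedness(Proofs)`, `PassiveScalarClassicalEnergy`
(`hasDerivWithinAt_scalarL2Sq_holds`, `scalarL2Sq_add_scalarDissipation_holds`, `restrict_Icc`,
`antitoneOn_scalarL2Sq`), `Torus.IsSmoothSpaceTimeOn` API (`TorusSpaceTime`). [folklore: lp-flux 3b /
DissipationTimeBoundsVariance; Shaw–Thiffeault–Doering physics/0607270 (I.11)] -/
theorem stub_coldStartVariance :
    ∀ (κ τ : ℝ) (u : ℝ → UnitAddTorus (Fin 2) → EuclideanSpace ℝ (Fin 2))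
      (h : UnitAddTorus (Fin 2) → ℝ) (S : Set (UnitAddTorus (Fin 2) → ℝ)),
      0 < κ → 0 < τ →
      Torus.IsSmoothSpaceTimeOn (Set.Ici 0) u → (∀ t ∈ Set.Ici (0 : ℝ), Torus.IsDivFree (u t)) →
      Torus.IsSmooth h →
      (∀ (s : ℝ), 0 ≤ s → ∀ φ : ℝ → UnitAddTorus (Fin 2) → ℝ,
          Torus.IsClassicalScalarTransportOn (Set.Icc s (s + τ)) κ u φ → φ s ∈ S →
          Torus.scalarL2Sq (φ (s + τ)) ≤ 4⁻¹ * Torus.scalarL2Sq (φ s)) →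
      (∀ (θ : ℝ → UnitAddTorus (Fin 2) → ℝ),
          Torus.IsClassicalScalarTransportForcedOn (Set.Ici 0) κ u (fun _ => h) θ →
          θ 0 = (fun _ => (0 : ℝ)) → ∀ t, 0 ≤ t → θ t ∈ S) →
      ∃ θ : ℝ → UnitAddTorus (Fin 2) → ℝ,
        Torus.IsClassicalScalarTransportForcedOn (Set.Ici 0) κ u (fun _ => h) θ ∧
        θ 0 = (fun _ => (0 : ℝ)) ∧
        ∀ t, 0 ≤ t → Torus.scalarL2Sq (θ t) ≤ 4 * τ ^ 2 * Torus.scalarL2Sq h := by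
  sorry

/-! ## S3 — the input-power floor survives: iterated halving kills the memory (K3 transfer) -/

/-- **S3 `stub_inputPowerFloor` — cold-start floor + iterated sector halving ⇒ eventual pointwise
input-power floor (M).** Same drift data as S2, plus (Inv-0) (releases with data in `S` stay in `S`),
the cold-start floor at lag `nτ` (`n ≥ 1`: every classical `h`-sourced solution on `[s, s+nτ]`,
`s ≥ 0`, from the zero datum has `∫ h·ρ(s+nτ) ≥ c₀`) and the coupling `4τ‖h‖² ≤ 2ⁿc₀`. THEN every
global classical cold start `θ` that stays in `S` and obeys the S2 bound `‖θ(t)‖² ≤ 4τ²‖h‖²` has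
`∫ h θ(t) ≥ c₀/2` for all `t ≥ nτ`. Proof route: for `t ≥ nτ` put `s = t - nτ ≥ 0` and split on
`[s, t]`: `θ = φ + ρ` with `φ` the classical release from `θ(s) ∈ S` (tree existence after time shift;
uniqueness `eq_on_Icc`) and `ρ = θ - φ` the cold start at `s`, a classical `h`-sourced solution on
`[s, s+nτ]` from `0`, so `(h, ρ(t)) ≥ c₀` (Floor); ITERATED HALVING: by (Inv-0) `φ(s+kτ) ∈ S`, by
restriction (`restrict_Icc`) and (Half) at release time `s+kτ`, `‖φ(s+nτ)‖² ≤ 4^{-n}‖θ(s)‖² ≤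
4^{-n}·4τ²‖h‖²`; Cauchy–Schwarz: `|(h, φ(t))| ≤ 2^{1-n}τ‖h‖² ≤ c₀/2` (small). Hence
`(h, θ(t)) ≥ c₀ - c₀/2`. Finite-window statement about the drift on `[t-nτ, t]` only — the
certifiable form of the card's K3 / ideator-4's Green–Kubo `FluxFloorCriterion` (whose
`∫₀^∞ (h, P_{s,s+L}h) dL ≥ c₀` is one way to PROVE (Floor)). Leans on: as S2 +
`integral_mul_le_Lp_mul_Lq`/Cauchy–Schwarz on `T²`. [folklore: Green–Kubo / no-revival, card K3] -/
theorem stub_inputPowerFloor :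
    ∀ (κ τ c₀ : ℝ) (n : ℕ) (u : ℝ → UnitAddTorus (Fin 2) → EuclideanSpace ℝ (Fin 2))
      (h : UnitAddTorus (Fin 2) → ℝ) (S : Set (UnitAddTorus (Fin 2) → ℝ))
      (θ : ℝ → UnitAddTorus (Fin 2) → ℝ),
      0 < κ → 0 < τ → 1 ≤ n →
      Torus.IsSmoothSpaceTimeOn (Set.Ici 0) u → (∀ t ∈ Set.Ici (0 : ℝ), Torus.IsDivFree (u t)) →
      Torus.IsSmooth h →
      4 * τ * Torus.scalarL2Sq h ≤ 2 ^ n * c₀ →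
      (∀ (s : ℝ), 0 ≤ s → ∀ φ : ℝ → UnitAddTorus (Fin 2) → ℝ,
          Torus.IsClassicalScalarTransportOn (Set.Icc s (s + τ)) κ u φ → φ s ∈ S →
          Torus.scalarL2Sq (φ (s + τ)) ≤ 4⁻¹ * Torus.scalarL2Sq (φ s)) →
      (∀ (s T' : ℝ), 0 ≤ s → ∀ φ : ℝ → UnitAddTorus (Fin 2) → ℝ,
          Torus.IsClassicalScalarTransportOn (Set.Icc s T') κ u φ → φ s ∈ S →
          ∀ t ∈ Set.Icc s T', φ t ∈ S) →
      (∀ (s : ℝ), 0 ≤ s → ∀ ρ : ℝ → UnitAddTorus (Fin 2) → ℝ,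
          Torus.IsClassicalScalarTransportForcedOn (Set.Icc s (s + n * τ)) κ u (fun _ => h) ρ →
          ρ s = (fun _ => (0 : ℝ)) → c₀ ≤ ∫ x, h x * ρ (s + n * τ) x) →
      Torus.IsClassicalScalarTransportForcedOn (Set.Ici 0) κ u (fun _ => h) θ →
      (∀ t, 0 ≤ t → θ t ∈ S) →
      (∀ t, 0 ≤ t → Torus.scalarL2Sq (θ t) ≤ 4 * τ ^ 2 * Torus.scalarL2Sq h) →
      ∀ t, n * τ ≤ t → c₀ / 2 ≤ ∫ x, h x * θ t x := by
  sorry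

/-! ## S4 — mean dissipation = mean input power (sourced `L²` balance in limsup form) -/

/-- **S4 `stub_dissipationFromPower` — the floor clause from an eventual input-power floor (M−).**
For a classical solution `θ` of `∂ₜθ + u·∇θ = κΔθ + h` on `T² × [0, ∞)` (`κ ≥ 0`) whose `L²` norm
is bounded (`‖θ(t)‖² ≤ B`, `t ≥ 0`) and whose input power is eventually floored
(`∫ h θ(t) ≥ e` for `t ≥ t₀`): `e ≤ limsup_T T⁻¹∫₀ᵀ κ‖∇θ(t)‖² dt`, with the crux's spectral
`Torus.eScalarGradNormSq` and `toReal`. Proof route: the sourced `L²` balance within `Ici 0`,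
`d/dt ‖θ(t)‖² = -2κ‖∇θ(t)‖² + 2∫ h θ(t)` (the forced twin of `hasDerivWithinAt_scalarL2Sq_holds`:
one extra term `∫ θ s`), FTC on `[0, T]`:
`T⁻¹∫₀ᵀ κ‖∇θ‖² = T⁻¹∫₀ᵀ (h, θ) - (‖θ(T)‖² - ‖θ(0)‖²)/(2T) ≥ e(T - t₀)/T - C(t₀)/T - B/(2T)`, so
`liminf ≥ e`, and `limsup ≥ liminf` (means bounded: `|(h,θ)| ≤ ‖h‖√B`); spectral = classical gradient
norm on smooth slices (`scalarGradNormSq_eq_toReal_holds`); interval integrability by continuity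
(`continuousOn_scalarGradNormSq`). Reusable by every Green–Kubo-type line on this crux
(flux-autocorrelation-split, lp-flux-locality-threshold). [cite: DoeringFoias2002 §2 (power =
dissipation in the mean); DEIJ2022 (1.2)–(1.3)] -/
theorem stub_dissipationFromPower :
    ∀ (κ B e t₀ : ℝ) (u : ℝ → UnitAddTorus (Fin 2) → EuclideanSpace ℝ (Fin 2))
      (h : UnitAddTorus (Fin 2) → ℝ) (θ : ℝ → UnitAddTorus (Fin 2) → ℝ),
      0 ≤ κ →
      Torus.IsClassicalScalarTransportForcedOn (Set.Ici 0) κ u (fun _ => h) θ →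
      (∀ t, 0 ≤ t → Torus.scalarL2Sq (θ t) ≤ B) →
      (∀ t, t₀ ≤ t → e ≤ ∫ x, h x * θ t x) →
      e ≤ longTimeAvgSup (fun t => κ * (Torus.eScalarGradNormSq (θ t)).toReal) := by
  sorry

/-! ## Composition — the crux BY NAME from S1–S4 (no sorry of its own) -/

/-- **`ScalarAnomalySteadySourceFormal_of`**: S1 (data, NS family, sector spec) → S2 (cold-start
scalars `θ_j` with `sup_t‖θ_j‖² ≤ 4τ²‖h‖²`, chosen per `j`) → S3 (input power `≥ c₀/2` after lag `nτ`)
→ S4 (`⟨ν_j‖∇θ_j‖²⟩ ≥ c₀/2`); then classical NS on `[0,∞)` ⇒ global Leray–Hopf with datum `v_j 0`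
(`IsClassicalNSSolutionOn.isLerayHopfOn_of_convex`), classical cold start ⇒ global weak sourced
solution with datum `θ_j 0 = 0 ∈ L²` (`Negative.isWeakScalarTransportForcedOn_of_classical`), and the
two `≤` clauses from the pointwise bounds (`meanEnergy_le_of_forall_le`,
`longTimeAvgSup_le_of_forall_le`). -/
theorem ScalarAnomalySteadySourceFormal_of :
    Summit.AnomalousDissipation.AnomalousDissipation.Theses.TwoAndHalfD.ScalarAnomalySteadySourceFormal := by
  obtain ⟨g, h, hgs, hgd, hgm, hhs, hhm, ν, v, p, S, τ, E, c₀, n, hν, hν0, hτ, hc₀, hn, hsmall,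
    hNS, hE, hInv0, hInvh, hHalf, hFloor⟩ := stub_sectorMixerRealizable
  -- S2: one global cold-start scalar per `j`, with the restart variance bound
  have hex : ∀ j, ∃ θ : ℝ → UnitAddTorus (Fin 2) → ℝ,
      Torus.IsClassicalScalarTransportForcedOn (Set.Ici 0) (ν j) (v j) (fun _ => h) θ ∧
      θ 0 = (fun _ => (0 : ℝ)) ∧
      ∀ t, 0 ≤ t → Torus.scalarL2Sq (θ t) ≤ 4 * τ ^ 2 * Torus.scalarL2Sq h := fun j =>
    stub_coldStartVariance (ν j) τ (v j) h (S j) (hν j) hτ (hNS j).smooth_velocity (hNS j).divFree hhs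
      (hHalf j) (hInvh j)
  choose θ hθ hθ0 hVar using hex
  have hS : ∀ j t, 0 ≤ t → θ j t ∈ S j := fun j => hInvh j (θ j) (hθ j) (hθ0 j)
  -- S3: eventual pointwise input-power floor
  have hpow : ∀ j t, n * τ ≤ t → c₀ / 2 ≤ ∫ x, h x * θ j t x := fun j =>
    stub_inputPowerFloor (ν j) τ c₀ n (v j) h (S j) (θ j) (hν j) hτ hn (hNS j).smooth_velocity
      (hNS j).divFree hhs hsmall (hHalf j) (hInv0 j) (hFloor j) (hθ j) (hS j) (hVar j)
  -- S4: the dissipation floor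
  have hflux : ∀ j, c₀ / 2 ≤
      longTimeAvgSup (fun t => ν j * (Torus.eScalarGradNormSq (θ j t)).toReal) := fun j =>
    stub_dissipationFromPower (ν j) (4 * τ ^ 2 * Torus.scalarL2Sq h) (c₀ / 2) (n * τ) (v j) h (θ j)
      (hν j).le (hθ j) (hVar j) (hpow j)
  refine ⟨g, h, hgs, hgd, hgm, hhs, hhm, ν, fun j => v j 0, v, fun j => θ j 0, θ, hν, hν0,
    ?_, ?_, ?_, ?_, ?_, ?_⟩
  · -- classical NS on `[0, ∞)` ⇒ global Leray–Hopf with datum `v j 0`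
    intro j T hT
    exact (hNS j).isLerayHopfOn_of_convex (convex_Ici 0) hT Set.Icc_subset_Ici_self
  · -- the zero datum is in `L²`
    intro j
    dsimp only
    rw [hθ0 j]
    exact memLp_const 0
  · -- classical cold start ⇒ global weak sourced solution
    intro j T hT
    exact Summit.AnomalousDissipation.AnomalousDissipation.Theorems.ScalarAnomalySteadySourceFormal.Negative.isWeakScalarTransportForcedOn_of_classical
      (hθ j) Set.Icc_subset_Ici_self
  · -- pointwise energy bound ⇒ limsup-mean energy bound
    exact ⟨E, fun j => Literature.Barriers.AnomalousDissipation.meanEnergy_le_of_forall_le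
      fun t ht => hE j t ht.le⟩
  · -- pointwise variance bound ⇒ limsup-mean variance bound
    exact ⟨4 * τ ^ 2 * Torus.scalarL2Sq h, fun j =>
      Literature.Barriers.AnomalousDissipation.longTimeAvgSup_le_of_forall_le
        (fun t _ => Torus.scalarL2Sq_nonneg _) fun t ht => hVar j t ht.le⟩
  · -- the anomaly
    exact ⟨c₀ / 2, half_pos hc₀, hflux⟩

end Summit.AnomalousDissipation.AnomalousDissipation.Cruxes.ScalarAnomalySteadySourceFormal.BudgetedMixerTemplate
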